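import Literature.NumberTheory.Sieve.MatomakiRadziwillLemma3VK
import Literature.NumberTheory.LFunctions.VinogradovZetaSumEstimate
import HarnessLib

/-!
# Matomäki–Radziwiłł 2016, Lemma 3 and Lemma 11 — discharged

Topic `Literature/NumberTheory/Sieve`.  Everything in this file is PROVED; it introduces no definition and
no named fact.  It discharges the two named facts of `MatomakiRadziwillProp1Inputs.lean` that were still
consumed as hypotheses (`(h3 : MatomakiRadziwill2016_lemma3)`, `(h11 : MatomakiRadziwill2016_lemma11)`):

* `MatomakiRadziwill2016_lemma3_holds` — K. Matomäki, M. Radziwiłł, *Multiplicative functions in short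
  intervals*, Ann. of Math. (2) 183 (2016), **Lemma 3** (§3; the Halász-type bound for
  `∑_{X ≤ n ≤ 2X} f(n) n^{-1-it}` over integers with a typical factorisation, as vendored);
* `MatomakiRadziwill2016_lemma11_holds` — ibid., **Lemma 11** (§7; for every `ε > 0` a constant `C` with
  `∑_{t ∈ 𝒯} |∑_{P ≤ p ≤ 2P} a_p p^{-it}|² ≤ C (P + |𝒯| P exp(-log P/(log T)^{2/3+ε}) (log T)²) ∑_p |a_p|²/log P`
  for `P, T ≥ 2` and `1`-spaced `𝒯 ⊂ [-T, T]`, as vendored).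

The file cannot be the module of the two `def`s (`MatomakiRadziwillProp1Inputs.lean` is imported by the
proofs), hence this sibling `…Holds` module.  Nothing is re-proved: both printed proofs are in the tree
conditionally on a Vinogradov–Korobov zero-free region — `MatomakiRadziwill2016_lemma3_of_vk`
(`MatomakiRadziwillLemma3VK.lean`: the Granville–Soundararajan form of Halász's theorem, proved, and the
Vinogradov–Korobov prime tail) and `MatomakiRadziwill2016_lemma11_of_vk` (`MatomakiRadziwillLemma11.lean`:
the twisted explicit formula in short intervals) — and the region is the tree theorem
`LFunctions.VKZeta.exists_hasVKZeroFreeRegion : ∃ c > 0, HasVKZeroFreeRegion c 21`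
(`LFunctions/VinogradovZetaSumEstimate.lean`, from Vinogradov's mean value theorem, Ivić 1985, Lemma 6.3
and Theorem 6.2).  Companion discharges: `MatomakiRadziwill2016_theorem1_holds`, `…_prop1_holds`
(`MatomakiRadziwillProofs.lean`), `…_theorem3_holds` (`MatomakiRadziwillTheorem3Holds.lean`),
`matomaki_radziwill_holds` (`ParityWave0MatomakiRadziwillHolds.lean`).

## References
* K. Matomäki, M. Radziwiłł, *Multiplicative functions in short intervals*, Ann. of Math. (2) 183
  (2016), no. 3, 1015–1056; doi:10.4007/annals.2016.183.3.6, arXiv:1501.04585 — Lemma 3 (§3) and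
  Lemma 11 (§7). [MatomakiRadziwillAnnals2016]
* A. Ivić, *The Riemann Zeta-Function*, John Wiley & Sons 1985 (Dover 2003), Lemma 6.3 and Theorem 6.2.
  [Ivic1985]
-/

noncomputable section

namespace Literature.NumberTheory.Sieve

open Literature.NumberTheory.LFunctions

/-- **Matomäki–Radziwiłł 2016, Lemma 3, proved**: the named fact `MatomakiRadziwill2016_lemma3`
(`MatomakiRadziwillProp1Inputs.lean`) holds — `MatomakiRadziwill2016_lemma3_of_vk` at the tree's
unconditional Vinogradov–Korobov region `VKZeta.exists_hasVKZeroFreeRegion`.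
[cite: MatomakiRadziwillAnnals2016, Lemma 3] -/
theorem MatomakiRadziwill2016_lemma3_holds : MatomakiRadziwill2016_lemma3 := by
  obtain ⟨c, hc, hVK⟩ := VKZeta.exists_hasVKZeroFreeRegion
  exact MatomakiRadziwill2016_lemma3_of_vk hc hVK

/-- **Matomäki–Radziwiłł 2016, Lemma 11, proved**: the named fact `MatomakiRadziwill2016_lemma11`
(`MatomakiRadziwillProp1Inputs.lean`) holds — `MatomakiRadziwill2016_lemma11_of_vk` at the tree's
unconditional Vinogradov–Korobov region `VKZeta.exists_hasVKZeroFreeRegion`.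
[cite: MatomakiRadziwillAnnals2016, Lemma 11] -/
theorem MatomakiRadziwill2016_lemma11_holds : MatomakiRadziwill2016_lemma11 := by
  obtain ⟨c, hc, hVK⟩ := VKZeta.exists_hasVKZeroFreeRegion
  exact MatomakiRadziwill2016_lemma11_of_vk hc hVK

end Literature.NumberTheory.Sieve
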